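import Literature.Computability.AlgebraicComplexity.LaserSymmetrization
import Literature.Computability.AlgebraicComplexity.MaxEntropyGivenMarginals
import Literature.Computability.AlgebraicComplexity.EntropyMajorisation
import HarnessLib

/-!
# Symmetrisation `t ⊗ t_C ⊗ t_{C²}`: the induced distribution `P ⊗ P ⊗ P`, its marginals and
entropies, and the penalty of the induced support (Le Gall 2014, proof of Thm. 4.1) — proved

Topic `Literature/Computability/AlgebraicComplexity`; companion of `LaserSymmetrization.lean`
(the induced decomposition of `t ⊗ t_C ⊗ t_{C²}`: labels, `symLabelEquiv`, `symSupport`).  In the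
proof of Le Gall's Thm. 4.1 (ISSAC 2014, arXiv:1401.7714, Appendix A.3) the typed support `Λ` of
`(t̄ ⊗ t̄_C ⊗ t̄_{C²})` has three projections of the common size
`T = |S̄₁| × |S̄₂| × |S̄₃| = Φ_{1,N}(P) Φ_{2,N}(P) Φ_{3,N}(P)` (p. 23) — in entropy terms: the
distribution induced on the label triples of `t ⊗ t_C ⊗ t_{C²}` by `P` is `P ⊗ P ⊗ P` (read through
`symLabelEquiv`), and each of its three marginals is a product `P_a ⊗ P_b ⊗ P_c` of the three
marginals of `P`, of entropy `H(P₁) + H(P₂) + H(P₃)`.  This file PROVES these facts and bounds the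
penalty of the induced support:

* `symDist P` — the induced distribution (`(X,Y,Z) ↦ P(s¹) P(s²) P(s³)`); non-negativity, total mass
  `1`, support in `symSupport S`, `shannonEntropy_symDist` (`H = 3 H(P)`).
* `marginalDist₁₂₃_symDist` — the marginals are `P₁(X₁)P₂(X₂)P₃(X₃)`, `P₂(Y₁)P₃(Y₂)P₁(Y₃)`,
  `P₃(Z₁)P₁(Z₂)P₂(Z₃)`; `shannonEntropy_marginalDist₁₂₃_symDist` — each has entropy
  `H(P₁)+H(P₂)+H(P₃)` (`sum_negMulLog_prod3`).
* `maxEntropyGivenMarginals_symSupport_symDist_le` — **`max_{D'} H ≤ 3 max_{D} H`** for the class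
  `D'` of `symDist P` on `symSupport S` against the class `D` of `P` on `S`: a competitor `Q'` is,
  through `symLabelEquiv`, a distribution on `S × S × S` whose three factor-projections lie in `D`
  (their marginals are marginals of marginals of `Q'`), and `H(Q') ≤ ∑ H(projections)`
  (subadditivity, `shannonEntropy_le_shannonEntropy_fst_add_snd`); hence
  `maxEntropyPenalty_symSupport_symDist_le`: **`Γ_{S'}(P⊗P⊗P) ≤ 3 Γ_S(P)`** (Le Gall bounds the
  corresponding count `N` by `(N+1)^{3|S|} ∏_ℓ max_Q Φ'_{ℓ,N}(P,Q)`, p. 24, which is this inequality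
  at the level of types).

Everything is proved; one definition (`symDist`); no named facts.

## References

* F. Le Gall, *Powers of tensors and fast matrix multiplication*, ISSAC 2014, arXiv:1401.7714
  (held: `paper:arxiv-1401.7714`): §3 (`Γ_S`), Appendix A.3 (pp. 22–24: `Λ`, `T`, `N`, `N*`).
  [LeGall2014]
-/

noncomputable section

open scoped BigOperators
open Finset Real

namespace Literature.Computability.AlgebraicComplexity

/-! ## Entropy helpers -/

section Helpers

variable {A B C : Type*} [Fintype A] [Fintype B] [Fintype C]

/-- Entropy is invariant under relabelling the alphabet. [folklore] -/
theorem shannonEntropy_comp_equiv (e : A ≃ B) (P : B → ℝ) :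
    shannonEntropy (P ∘ e) = shannonEntropy P := by
  simp only [shannonEntropy_def, Function.comp_apply]
  rw [Equiv.sum_comp e (fun b => negMulLog (P b))]

/-- `∑_{(a,b,c)} p_a q_b r_c = (∑ p)(∑ q)(∑ r)` (in any semiring). [folklore] -/
theorem sum_prod3 {R : Type*} [NonUnitalNonAssocSemiring R] (p : A → R) (q : B → R) (r : C → R) :
    ∑ x : A × B × C, p x.1 * q x.2.1 * r x.2.2 = (∑ a, p a) * (∑ b, q b) * ∑ c, r c := by
  rw [Fintype.sum_prod_type, Finset.sum_mul_sum, Finset.sum_mul]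
  refine Finset.sum_congr rfl fun a _ => ?_
  rw [Fintype.sum_prod_type, Finset.sum_mul]
  refine Finset.sum_congr rfl fun b _ => ?_
  rw [Finset.mul_sum]

/-- `∑_{b,c} k (f_b g_c) = k ((∑ f)(∑ g))`. [folklore] -/
theorem sum_sum_mul_mul' (k : ℝ) (f : B → ℝ) (g : C → ℝ) :
    ∑ b, ∑ c, k * (f b * g c) = k * ((∑ b, f b) * ∑ c, g c) := by
  rw [Finset.sum_mul_sum, Finset.mul_sum]
  refine Finset.sum_congr rfl fun b _ => ?_
  rw [Finset.mul_sum]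

/-- `∑_{b,c} k f_b g_c = k (∑ f)(∑ g)`. [folklore] -/
theorem sum_sum_const_mul_mul (k : ℝ) (f : B → ℝ) (g : C → ℝ) :
    ∑ b, ∑ c, k * f b * g c = k * (∑ b, f b) * ∑ c, g c := by
  rw [mul_assoc, ← sum_sum_mul_mul']
  exact Finset.sum_congr rfl fun b _ => Finset.sum_congr rfl fun c _ => by ring

/-- `∑_{a,c} f_a k g_c = (∑ f) k (∑ g)`. [folklore] -/
theorem sum_sum_mul_const_mul (k : ℝ) (f : A → ℝ) (g : C → ℝ) :
    ∑ a, ∑ c, f a * k * g c = (∑ a, f a) * k * ∑ c, g c := by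
  rw [show (∑ a, f a) * k * ∑ c, g c = k * ((∑ a, f a) * ∑ c, g c) by ring, ← sum_sum_mul_mul']
  exact Finset.sum_congr rfl fun a _ => Finset.sum_congr rfl fun c _ => by ring

/-- `∑_{a,b} f_a g_b k = (∑ f)(∑ g) k`. [folklore] -/
theorem sum_sum_mul_mul_const (k : ℝ) (f : A → ℝ) (g : B → ℝ) :
    ∑ a, ∑ b, f a * g b * k = (∑ a, f a) * (∑ b, g b) * k := by
  rw [show (∑ a, f a) * (∑ b, g b) * k = k * ((∑ a, f a) * ∑ b, g b) by ring, ← sum_sum_mul_mul']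
  exact Finset.sum_congr rfl fun a _ => Finset.sum_congr rfl fun b _ => by ring

/-- `∑_{(a,b,c)} η(p_a q_b r_c) = ∑ η(p) + ∑ η(q) + ∑ η(r)` for vectors of total mass `1`
(`η = negMulLog`). [folklore] -/
theorem sum_negMulLog_prod3 (p : A → ℝ) (q : B → ℝ) (r : C → ℝ) (hp : ∑ a, p a = 1)
    (hq : ∑ b, q b = 1) (hr : ∑ c, r c = 1) :
    ∑ x : A × B × C, negMulLog (p x.1 * q x.2.1 * r x.2.2) =
      ∑ a, negMulLog (p a) + ∑ b, negMulLog (q b) + ∑ c, negMulLog (r c) := by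
  have key : ∀ x : A × B × C, negMulLog (p x.1 * q x.2.1 * r x.2.2) =
      negMulLog (p x.1) * q x.2.1 * r x.2.2 + p x.1 * negMulLog (q x.2.1) * r x.2.2 +
        p x.1 * q x.2.1 * negMulLog (r x.2.2) := by
    intro x; rw [negMulLog_mul, negMulLog_mul]; ring
  simp_rw [key]
  rw [Finset.sum_add_distrib, Finset.sum_add_distrib,
    sum_prod3 (fun a => negMulLog (p a)) q r, sum_prod3 p (fun b => negMulLog (q b)) r,
    sum_prod3 p q (fun c => negMulLog (r c)), hp, hq, hr]
  ring

/-- `H(p ⊗ q ⊗ r) = H(p) + H(q) + H(r)` for vectors of total mass `1`. [folklore] -/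
theorem shannonEntropy_prod3 (p : A → ℝ) (q : B → ℝ) (r : C → ℝ) (hp : ∑ a, p a = 1)
    (hq : ∑ b, q b = 1) (hr : ∑ c, r c = 1) :
    shannonEntropy (fun x : A × B × C => p x.1 * q x.2.1 * r x.2.2) =
      shannonEntropy p + shannonEntropy q + shannonEntropy r := by
  simp only [shannonEntropy_def]
  rw [sum_negMulLog_prod3 p q r hp hq hr, add_div, add_div]

/-- `∑_x [x₁ = a] f(x) = ∑_{b,c} f(a,b,c)`. [folklore] -/
theorem sum_ite_fst_eq [DecidableEq A] (f : A × B × C → ℝ) (a : A) :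
    (∑ x : A × B × C, if x.1 = a then f x else 0) = ∑ b, ∑ c, f (a, b, c) := by
  rw [Fintype.sum_prod_type, Finset.sum_eq_single_of_mem a (Finset.mem_univ a)
    (fun a' _ ha' => by simp [ha'])]
  simp [Fintype.sum_prod_type]

/-- `∑_x [x₂ = b] f(x) = ∑_{a,c} f(a,b,c)`. [folklore] -/
theorem sum_ite_snd_fst_eq [DecidableEq B] (f : A × B × C → ℝ) (b : B) :
    (∑ x : A × B × C, if x.2.1 = b then f x else 0) = ∑ a, ∑ c, f (a, b, c) := by
  rw [Fintype.sum_prod_type]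
  refine Finset.sum_congr rfl fun a _ => ?_
  rw [Fintype.sum_prod_type, Finset.sum_eq_single_of_mem b (Finset.mem_univ b)
    (fun b' _ hb' => by simp [hb'])]
  simp

/-- `∑_x [x₃ = c] f(x) = ∑_{a,b} f(a,b,c)`. [folklore] -/
theorem sum_ite_snd_snd_eq [DecidableEq C] (f : A × B × C → ℝ) (c : C) :
    (∑ x : A × B × C, if x.2.2 = c then f x else 0) = ∑ a, ∑ b, f (a, b, c) := by
  rw [Fintype.sum_prod_type]
  refine Finset.sum_congr rfl fun a _ => ?_
  rw [Fintype.sum_prod_type]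
  refine Finset.sum_congr rfl fun b _ => ?_
  rw [Finset.sum_eq_single_of_mem c (Finset.mem_univ c) (fun c' _ hc' => by simp [hc'])]
  simp

end Helpers

/-! ## The induced distribution `P ⊗ P ⊗ P` -/

section SymDist

variable {I J L : Type*}

/-- **The distribution induced on the label triples of `t ⊗ t_C ⊗ t_{C²}`** by a distribution `P`
on the labels of `t`: `(X,Y,Z) ↦ P(s¹) P(s²) P(s³)`, `(s¹,s²,s³) = symLabelEquiv (X,Y,Z)` (Le Gall,
Appendix A.3: the types of `Λ` are triples of types). [cite: LeGall2014, Appendix A.3] -/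
def symDist (P : I × J × L → ℝ) : (I × J × L) × (J × L × I) × (L × I × J) → ℝ :=
  fun XYZ => P (symLabelEquiv I J L XYZ).1 * P (symLabelEquiv I J L XYZ).2.1 *
    P (symLabelEquiv I J L XYZ).2.2

/-- Entries of `symDist`. [folklore] -/
theorem symDist_apply (P : I × J × L → ℝ) (X : I × J × L) (Y : J × L × I) (Z : L × I × J) :
    symDist P (X, Y, Z) = P (X.1, Y.1, Z.1) * P (Z.2.1, X.2.1, Y.2.1) * P (Y.2.2, Z.2.2, X.2.2) :=
  rfl

/-- Through `symLabelEquiv`, `symDist P` is the product `P ⊗ P ⊗ P`. [folklore] -/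
theorem symDist_symm_apply (P : I × J × L → ℝ) (T : (I × J × L) × (I × J × L) × (I × J × L)) :
    symDist P ((symLabelEquiv I J L).symm T) = P T.1 * P T.2.1 * P T.2.2 := by
  simp only [symDist, Equiv.apply_symm_apply]

/-- `symDist P ≥ 0` for `P ≥ 0`. [folklore] -/
theorem symDist_nonneg {P : I × J × L → ℝ} (hP0 : ∀ s, 0 ≤ P s)
    (XYZ : (I × J × L) × (J × L × I) × (L × I × J)) : 0 ≤ symDist P XYZ :=
  mul_nonneg (mul_nonneg (hP0 _) (hP0 _)) (hP0 _)

variable [Fintype I] [Fintype J] [Fintype L]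

/-- `∑ symDist P = (∑ P)³ = 1`. [folklore] -/
theorem sum_symDist {P : I × J × L → ℝ} (hP1 : ∑ s, P s = 1) : ∑ XYZ, symDist P XYZ = 1 := by
  rw [← Equiv.sum_comp (symLabelEquiv I J L).symm]
  simp only [symDist_symm_apply]
  rw [sum_prod3, hP1]; ring

/-- `symDist P` is a probability distribution when `P` is. [folklore] -/
theorem symDist_mem_stdSimplex {P : I × J × L → ℝ} (hP0 : ∀ s, 0 ≤ P s) (hP1 : ∑ s, P s = 1) :
    symDist P ∈ stdSimplex ℝ ((I × J × L) × (J × L × I) × (L × I × J)) :=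
  ⟨symDist_nonneg hP0, sum_symDist hP1⟩

/-- **`H(P ⊗ P ⊗ P) = 3 H(P)`.** [folklore] -/
theorem shannonEntropy_symDist {P : I × J × L → ℝ} (hP1 : ∑ s, P s = 1) :
    shannonEntropy (symDist P) = 3 * shannonEntropy P := by
  have h : symDist P = (fun T : (I × J × L) × (I × J × L) × (I × J × L) => P T.1 * P T.2.1 * P T.2.2) ∘
      symLabelEquiv I J L := by
    funext XYZ; rfl
  rw [h, shannonEntropy_comp_equiv, shannonEntropy_prod3 P P P hP1 hP1 hP1]; ring

variable [DecidableEq I] [DecidableEq J] [DecidableEq L]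

/-- `symDist P` is supported in the induced support of any `S ⊇ supp P`. [folklore] -/
theorem symDist_eq_zero {S : Finset (I × J × L)} {P : I × J × L → ℝ} (hPS : ∀ s, s ∉ S → P s = 0)
    (XYZ : (I × J × L) × (J × L × I) × (L × I × J)) (h : XYZ ∉ symSupport S) : symDist P XYZ = 0 := by
  rw [mem_symSupport] at h
  simp only [symDist]
  by_cases h1 : (symLabelEquiv I J L XYZ).1 ∈ S
  · by_cases h2 : (symLabelEquiv I J L XYZ).2.1 ∈ S
    · have h3 : (symLabelEquiv I J L XYZ).2.2 ∉ S := fun h3 => h ⟨h1, h2, h3⟩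
      rw [hPS _ h3, mul_zero]
    · rw [hPS _ h2, mul_zero, zero_mul]
  · rw [hPS _ h1, zero_mul, zero_mul]

/-! ### The marginals of `P ⊗ P ⊗ P` -/

omit [DecidableEq I] [DecidableEq J] [DecidableEq L] in
/-- **The `x`-marginal of the induced distribution is `P₁(X₁) P₂(X₂) P₃(X₃)`.**
[cite: LeGall2014, Appendix A.3 (T = |S̄₁||S̄₂||S̄₃|)] -/
theorem marginalDist₁_symDist (P : I × J × L → ℝ) :
    marginalDist₁ (symDist P) = fun X =>
      marginalDist₁ P X.1 * marginalDist₂ P X.2.1 * marginalDist₃ P X.2.2 := by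
  funext X
  simp only [marginalDist₁, marginalDist₂, marginalDist₃]
  -- both sides as single sums over a product type
  rw [← Fintype.sum_prod_type' (f := fun (Y : J × L × I) (Z : L × I × J) => symDist P (X, Y, Z))]
  rw [← Fintype.sum_prod_type' (f := fun (b : J) (c : L) => P (X.1, b, c)),
    ← Fintype.sum_prod_type' (f := fun (a : I) (c : L) => P (a, X.2.1, c)),
    ← Fintype.sum_prod_type' (f := fun (a : I) (b : J) => P (a, b, X.2.2))]
  rw [← sum_prod3]
  refine Fintype.sum_equiv
    ⟨fun YZ => ((YZ.1.1, YZ.2.1), (YZ.2.2.1, YZ.1.2.1), (YZ.1.2.2, YZ.2.2.2)),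
     fun U => ((U.1.1, U.2.1.2, U.2.2.1), (U.1.2, U.2.1.1, U.2.2.2)),
     fun YZ => by obtain ⟨⟨a, b, c⟩, ⟨d, e, f⟩⟩ := YZ; rfl,
     fun U => by obtain ⟨⟨a, b⟩, ⟨c, d⟩, ⟨e, f⟩⟩ := U; rfl⟩ _ _ fun YZ => ?_
  rfl

omit [DecidableEq I] [DecidableEq J] [DecidableEq L] in
/-- **The `y`-marginal of the induced distribution is `P₂(Y₁) P₃(Y₂) P₁(Y₃)`.**
[cite: LeGall2014, Appendix A.3 (T = |S̄₁||S̄₂||S̄₃|)] -/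
theorem marginalDist₂_symDist (P : I × J × L → ℝ) :
    marginalDist₂ (symDist P) = fun Y =>
      marginalDist₂ P Y.1 * marginalDist₃ P Y.2.1 * marginalDist₁ P Y.2.2 := by
  funext Y
  simp only [marginalDist₁, marginalDist₂, marginalDist₃]
  rw [← Fintype.sum_prod_type' (f := fun (X : I × J × L) (Z : L × I × J) => symDist P (X, Y, Z))]
  rw [← Fintype.sum_prod_type' (f := fun (a : I) (c : L) => P (a, Y.1, c)),
    ← Fintype.sum_prod_type' (f := fun (a : I) (b : J) => P (a, b, Y.2.1)),
    ← Fintype.sum_prod_type' (f := fun (b : J) (c : L) => P (Y.2.2, b, c))]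
  rw [← sum_prod3]
  refine Fintype.sum_equiv
    ⟨fun XZ => ((XZ.1.1, XZ.2.1), (XZ.2.2.1, XZ.1.2.1), (XZ.2.2.2, XZ.1.2.2)),
     fun U => ((U.1.1, U.2.1.2, U.2.2.2), (U.1.2, U.2.1.1, U.2.2.1)),
     fun XZ => by obtain ⟨⟨a, b, c⟩, ⟨d, e, f⟩⟩ := XZ; rfl,
     fun U => by obtain ⟨⟨a, b⟩, ⟨c, d⟩, ⟨e, f⟩⟩ := U; rfl⟩ _ _ fun XZ => ?_
  rfl

omit [DecidableEq I] [DecidableEq J] [DecidableEq L] in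
/-- **The `z`-marginal of the induced distribution is `P₃(Z₁) P₁(Z₂) P₂(Z₃)`.**
[cite: LeGall2014, Appendix A.3 (T = |S̄₁||S̄₂||S̄₃|)] -/
theorem marginalDist₃_symDist (P : I × J × L → ℝ) :
    marginalDist₃ (symDist P) = fun Z =>
      marginalDist₃ P Z.1 * marginalDist₁ P Z.2.1 * marginalDist₂ P Z.2.2 := by
  funext Z
  simp only [marginalDist₁, marginalDist₂, marginalDist₃]
  rw [← Fintype.sum_prod_type' (f := fun (X : I × J × L) (Y : J × L × I) => symDist P (X, Y, Z))]
  rw [← Fintype.sum_prod_type' (f := fun (a : I) (b : J) => P (a, b, Z.1)),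
    ← Fintype.sum_prod_type' (f := fun (b : J) (c : L) => P (Z.2.1, b, c)),
    ← Fintype.sum_prod_type' (f := fun (a : I) (c : L) => P (a, Z.2.2, c))]
  rw [← sum_prod3]
  refine Fintype.sum_equiv
    ⟨fun XY => ((XY.1.1, XY.2.1), (XY.1.2.1, XY.2.2.1), (XY.2.2.2, XY.1.2.2)),
     fun U => ((U.1.1, U.2.1.1, U.2.2.2), (U.1.2, U.2.1.2, U.2.2.1)),
     fun XY => by obtain ⟨⟨a, b, c⟩, ⟨d, e, f⟩⟩ := XY; rfl,
     fun U => by obtain ⟨⟨a, b⟩, ⟨c, d⟩, ⟨e, f⟩⟩ := U; rfl⟩ _ _ fun XY => ?_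
  rfl

omit [DecidableEq I] [DecidableEq J] [DecidableEq L] in
/-- The marginals of a probability vector have total mass `1`. [folklore] -/
theorem sum_marginalDist₁₂₃ {P : I × J × L → ℝ} (hP1 : ∑ s, P s = 1) :
    ∑ i, marginalDist₁ P i = 1 ∧ ∑ j, marginalDist₂ P j = 1 ∧ ∑ l, marginalDist₃ P l = 1 := by
  refine ⟨?_, ?_, ?_⟩
  · rw [← hP1]
    simp only [marginalDist₁, Fintype.sum_prod_type]
  · rw [← hP1]
    simp only [marginalDist₂, Fintype.sum_prod_type]
    exact Finset.sum_comm
  · rw [← hP1]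
    simp only [marginalDist₃, Fintype.sum_prod_type]
    rw [Finset.sum_comm]
    exact Finset.sum_congr rfl fun i _ => Finset.sum_comm

omit [DecidableEq I] [DecidableEq J] [DecidableEq L] in
/-- **Each marginal of `P ⊗ P ⊗ P` has entropy `H(P₁) + H(P₂) + H(P₃)`** — the entropy form of
Le Gall's "`|β_ℓ(Λ)| = T = Φ_{1,N}(P) Φ_{2,N}(P) Φ_{3,N}(P)` for each `ℓ`".
[cite: LeGall2014, Appendix A.3 (p. 23)] -/
theorem shannonEntropy_marginalDist_symDist {P : I × J × L → ℝ} (hP1 : ∑ s, P s = 1) :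
    shannonEntropy (marginalDist₁ (symDist P)) =
        shannonEntropy (marginalDist₁ P) + shannonEntropy (marginalDist₂ P) +
          shannonEntropy (marginalDist₃ P) ∧
      shannonEntropy (marginalDist₂ (symDist P)) =
        shannonEntropy (marginalDist₁ P) + shannonEntropy (marginalDist₂ P) +
          shannonEntropy (marginalDist₃ P) ∧
      shannonEntropy (marginalDist₃ (symDist P)) =
        shannonEntropy (marginalDist₁ P) + shannonEntropy (marginalDist₂ P) +
          shannonEntropy (marginalDist₃ P) := by
  obtain ⟨h1, h2, h3⟩ := sum_marginalDist₁₂₃ hP1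
  refine ⟨?_, ?_, ?_⟩
  · rw [marginalDist₁_symDist, shannonEntropy_prod3 _ _ _ h1 h2 h3]
  · rw [marginalDist₂_symDist, shannonEntropy_prod3 _ _ _ h2 h3 h1]; ring
  · rw [marginalDist₃_symDist, shannonEntropy_prod3 _ _ _ h3 h1 h2]; ring

end SymDist

/-! ## The penalty of the induced support: `Γ_{S'}(P ⊗ P ⊗ P) ≤ 3 Γ_S(P)` -/

section Penalty

variable {I J L : Type*} [Fintype I] [Fintype J] [Fintype L] [DecidableEq I] [DecidableEq J]
  [DecidableEq L]

omit [DecidableEq I] [DecidableEq J] [DecidableEq L] in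
/-- Transport of indicator sums through `symLabelEquiv`: a sum over triples `(s¹,s²,s³)` restricted by
a coordinate is the same sum over label triples. [folklore] -/
theorem sum_ite_symLabelEquiv {α : Type*} [DecidableEq α]
    (Q' : (I × J × L) × (J × L × I) × (L × I × J) → ℝ)
    (c : (I × J × L) × (I × J × L) × (I × J × L) → α)
    (c' : (I × J × L) × (J × L × I) × (L × I × J) → α) (hcc' : ∀ XYZ, c (symLabelEquiv I J L XYZ) = c' XYZ)
    (v : α) :
    (∑ T, if c T = v then Q' ((symLabelEquiv I J L).symm T) else 0) =
      ∑ XYZ, if c' XYZ = v then Q' XYZ else 0 := by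
  rw [← Equiv.sum_comp (symLabelEquiv I J L)]
  refine Finset.sum_congr rfl fun XYZ _ => ?_
  rw [hcc', Equiv.symm_apply_apply]

/-- Pulling an indicator on the first summation variable out of a triple sum. [folklore] -/
theorem sum_ite_fst_sum₃ {α β γ : Type*} [Fintype α] [Fintype β] [Fintype γ] (p : α → Prop)
    [DecidablePred p] (f : α → β → γ → ℝ) :
    (∑ x : α × β × γ, if p x.1 then f x.1 x.2.1 x.2.2 else 0) =
      ∑ a, if p a then ∑ b, ∑ c, f a b c else 0 := by
  rw [Fintype.sum_prod_type]
  refine Finset.sum_congr rfl fun a _ => ?_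
  split_ifs with h
  · exact Fintype.sum_prod_type _
  · simp

/-- Pulling an indicator on the second summation variable out of a triple sum. [folklore] -/
theorem sum_ite_snd_sum₃ {α β γ : Type*} [Fintype α] [Fintype β] [Fintype γ] (p : β → Prop)
    [DecidablePred p] (f : α → β → γ → ℝ) :
    (∑ x : α × β × γ, if p x.2.1 then f x.1 x.2.1 x.2.2 else 0) =
      ∑ b, if p b then ∑ a, ∑ c, f a b c else 0 := by
  rw [Fintype.sum_prod_type]
  simp only [Fintype.sum_prod_type]
  rw [Finset.sum_comm]
  refine Finset.sum_congr rfl fun b _ => ?_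
  split_ifs with h
  · rfl
  · simp

/-- Pulling an indicator on the third summation variable out of a triple sum. [folklore] -/
theorem sum_ite_thd_sum₃ {α β γ : Type*} [Fintype α] [Fintype β] [Fintype γ] (p : γ → Prop)
    [DecidablePred p] (f : α → β → γ → ℝ) :
    (∑ x : α × β × γ, if p x.2.2 then f x.1 x.2.1 x.2.2 else 0) =
      ∑ c, if p c then ∑ a, ∑ b, f a b c else 0 := by
  rw [Fintype.sum_prod_type]
  simp only [Fintype.sum_prod_type]
  have : ∀ a, (∑ b, ∑ c, if p c then f a b c else 0) = ∑ c, ∑ b, if p c then f a b c else 0 :=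
    fun a => Finset.sum_comm
  simp_rw [this]
  rw [Finset.sum_comm]
  refine Finset.sum_congr rfl fun c _ => ?_
  split_ifs with h
  · rfl
  · simp

/-- **`max_{D'} H ≤ 3 · max_D H`**: every distribution `Q'` on the induced support with the marginals
of `P ⊗ P ⊗ P` has entropy at most three times the maximum entropy over the distributions on `S`
with the marginals of `P` (its three factor-projections lie in that class; subadditivity).
[cite: LeGall2014, Appendix A.3 (p. 24, the bound on N)] -/
theorem maxEntropyGivenMarginals_symSupport_symDist_le (S : Finset (I × J × L))
    {P : I × J × L → ℝ} (hP0 : ∀ s, 0 ≤ P s) (hP1 : ∑ s, P s = 1) (hPS : ∀ s, s ∉ S → P s = 0) :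
    maxEntropyGivenMarginals (symSupport S) (symDist P) ≤ 3 * maxEntropyGivenMarginals S P := by
  classical
  obtain ⟨hs1, hs2, hs3⟩ := sum_marginalDist₁₂₃ hP1
  refine maxEntropyGivenMarginals_le
    ⟨symDist P, self_mem_sameMarginalsOn (symDist_mem_stdSimplex hP0 hP1) (symDist_eq_zero hPS)⟩
    fun Q' hQ' => ?_
  obtain ⟨hQ's, hQ'supp, hm1, hm2, hm3⟩ := hQ'
  rw [marginalDist₁_symDist] at hm1
  rw [marginalDist₂_symDist] at hm2
  rw [marginalDist₃_symDist] at hm3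
  -- indicator sums of the three marginals of `Q'`
  have eX1 : ∀ i, (∑ X : I × J × L, if X.1 = i then marginalDist₁ Q' X else 0) = marginalDist₁ P i := by
    intro i; rw [hm1, sum_ite_fst_eq]; dsimp only; rw [sum_sum_const_mul_mul, hs2, hs3]; ring
  have eX2 : ∀ j, (∑ X : I × J × L, if X.2.1 = j then marginalDist₁ Q' X else 0) = marginalDist₂ P j := by
    intro j; rw [hm1, sum_ite_snd_fst_eq]; dsimp only; rw [sum_sum_mul_const_mul, hs1, hs3]; ring
  have eX3 : ∀ l, (∑ X : I × J × L, if X.2.2 = l then marginalDist₁ Q' X else 0) = marginalDist₃ P l := by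
    intro l; rw [hm1, sum_ite_snd_snd_eq]; dsimp only; rw [sum_sum_mul_mul_const, hs1, hs2]; ring
  have eY1 : ∀ j, (∑ Y : J × L × I, if Y.1 = j then marginalDist₂ Q' Y else 0) = marginalDist₂ P j := by
    intro j; rw [hm2, sum_ite_fst_eq]; dsimp only; rw [sum_sum_const_mul_mul, hs3, hs1]; ring
  have eY2 : ∀ l, (∑ Y : J × L × I, if Y.2.1 = l then marginalDist₂ Q' Y else 0) = marginalDist₃ P l := by
    intro l; rw [hm2, sum_ite_snd_fst_eq]; dsimp only; rw [sum_sum_mul_const_mul, hs2, hs1]; ring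
  have eY3 : ∀ i, (∑ Y : J × L × I, if Y.2.2 = i then marginalDist₂ Q' Y else 0) = marginalDist₁ P i := by
    intro i; rw [hm2, sum_ite_snd_snd_eq]; dsimp only; rw [sum_sum_mul_mul_const, hs2, hs3]; ring
  have eZ1 : ∀ l, (∑ Z : L × I × J, if Z.1 = l then marginalDist₃ Q' Z else 0) = marginalDist₃ P l := by
    intro l; rw [hm3, sum_ite_fst_eq]; dsimp only; rw [sum_sum_const_mul_mul, hs1, hs2]; ring
  have eZ2 : ∀ i, (∑ Z : L × I × J, if Z.2.1 = i then marginalDist₃ Q' Z else 0) = marginalDist₁ P i := by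
    intro i; rw [hm3, sum_ite_snd_fst_eq]; dsimp only; rw [sum_sum_mul_const_mul, hs3, hs2]; ring
  have eZ3 : ∀ j, (∑ Z : L × I × J, if Z.2.2 = j then marginalDist₃ Q' Z else 0) = marginalDist₂ P j := by
    intro j; rw [hm3, sum_ite_snd_snd_eq]; dsimp only; rw [sum_sum_mul_mul_const, hs3, hs1]; ring
  -- the same sums read on all label triples
  have bX : ∀ (p : I × J × L → Prop) [DecidablePred p],
      (∑ XYZ : (I × J × L) × (J × L × I) × (L × I × J), if p XYZ.1 then Q' XYZ else 0) =
        ∑ X, if p X then marginalDist₁ Q' X else 0 := fun p _ =>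
    sum_ite_fst_sum₃ p fun X Y Z => Q' (X, Y, Z)
  have bY : ∀ (p : J × L × I → Prop) [DecidablePred p],
      (∑ XYZ : (I × J × L) × (J × L × I) × (L × I × J), if p XYZ.2.1 then Q' XYZ else 0) =
        ∑ Y, if p Y then marginalDist₂ Q' Y else 0 := fun p _ =>
    sum_ite_snd_sum₃ p fun X Y Z => Q' (X, Y, Z)
  have bZ : ∀ (p : L × I × J → Prop) [DecidablePred p],
      (∑ XYZ : (I × J × L) × (J × L × I) × (L × I × J), if p XYZ.2.2 then Q' XYZ else 0) =
        ∑ Z, if p Z then marginalDist₃ Q' Z else 0 := fun p _ =>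
    sum_ite_thd_sum₃ p fun X Y Z => Q' (X, Y, Z)
  -- `Q'` read on triples `(s¹, s², s³)`
  set G := symLabelEquiv I J L with hG
  set Qt : (I × J × L) × (I × J × L) × (I × J × L) → ℝ := fun T => Q' (G.symm T) with hQt
  have hQt0 : ∀ T, 0 ≤ Qt T := fun T => hQ's.1 _
  have hQt1 : ∑ T, Qt T = 1 := by
    simp only [hQt]; rw [Equiv.sum_comp G.symm Q']; exact hQ's.2
  have hQtsimp : Qt ∈ stdSimplex ℝ _ := ⟨hQt0, hQt1⟩
  have hQtS : ∀ T, ¬(T.1 ∈ S ∧ T.2.1 ∈ S ∧ T.2.2 ∈ S) → Qt T = 0 := fun T hT =>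
    hQ'supp _ (fun h => hT (symm_mem_symSupport.1 h))
  have hHQ : shannonEntropy Q' = shannonEntropy Qt := by
    rw [show Qt = Q' ∘ G.symm from rfl, shannonEntropy_comp_equiv]
  -- transport of the nine coordinate indicator sums
  have tr : ∀ (c : (I × J × L) × (I × J × L) × (I × J × L) → Prop)
      (c' : (I × J × L) × (J × L × I) × (L × I × J) → Prop) [DecidablePred c] [DecidablePred c'],
      (∀ XYZ, c (G XYZ) ↔ c' XYZ) →
      (∑ T, if c T then Qt T else 0) = ∑ XYZ, if c' XYZ then Q' XYZ else 0 := by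
    intro c c' _ _ hcc'
    rw [← Equiv.sum_comp G]
    refine Finset.sum_congr rfl fun XYZ _ => ?_
    have h1 : Qt (G XYZ) = Q' XYZ := by simp only [hQt, Equiv.symm_apply_apply]
    rw [h1]
    exact if_congr (hcc' XYZ) rfl rfl
  -- subadditivity
  have hsub1 := shannonEntropy_le_shannonEntropy_fst_add_snd hQtsimp
  set pr₁ : I × J × L → ℝ := fun a => ∑ b, Qt (a, b) with hpr₁
  set Q23 : (I × J × L) × (I × J × L) → ℝ := fun b => ∑ a, Qt (a, b) with hQ23
  have hQ23simp : Q23 ∈ stdSimplex ℝ _ := by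
    refine ⟨fun b => Finset.sum_nonneg fun a _ => hQt0 _, ?_⟩
    simp only [hQ23]
    rw [Finset.sum_comm, ← hQt1]
    exact (Fintype.sum_prod_type Qt).symm
  have hsub2 := shannonEntropy_le_shannonEntropy_fst_add_snd hQ23simp
  set pr₂ : I × J × L → ℝ := fun a => ∑ b, Q23 (a, b) with hpr₂
  set pr₃ : I × J × L → ℝ := fun b => ∑ a, Q23 (a, b) with hpr₃
  -- unfolded forms of the projections
  have pr₁_eq : ∀ s, pr₁ s = ∑ b, ∑ c, Qt (s, b, c) := fun s => Fintype.sum_prod_type _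
  have pr₂_eq : ∀ s, pr₂ s = ∑ a, ∑ c, Qt (a, s, c) := fun s => by
    simp only [hpr₂, hQ23]; exact Finset.sum_comm
  have pr₃_eq : ∀ s, pr₃ s = ∑ a, ∑ b, Qt (a, b, s) := fun s => by
    simp only [hpr₃, hQ23]; exact Finset.sum_comm
  -- the three projections lie in the class of `P`
  have mem₁ : pr₁ ∈ sameMarginalsOn S P := by
    refine ⟨⟨fun s => Finset.sum_nonneg fun b _ => hQt0 _, ?_⟩, fun s hs => ?_, ?_, ?_, ?_⟩
    · simp only [hpr₁]
      rw [← hQt1]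
      exact (Fintype.sum_prod_type Qt).symm
    · simp only [hpr₁]
      exact Finset.sum_eq_zero fun b _ => hQtS _ fun h => hs h.1
    · funext i
      calc marginalDist₁ pr₁ i = ∑ s : I × J × L, if s.1 = i then pr₁ s else 0 :=
            (sum_ite_fst_eq pr₁ i).symm
        _ = ∑ T, if T.1.1 = i then Qt T else 0 := by
            simp_rw [pr₁_eq]; exact (sum_ite_fst_sum₃ (fun s : I × J × L => s.1 = i) _).symm
        _ = ∑ XYZ, if XYZ.1.1 = i then Q' XYZ else 0 :=
            tr (fun T => T.1.1 = i) (fun XYZ => XYZ.1.1 = i) fun _ => Iff.rfl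
        _ = marginalDist₁ P i := by rw [bX (fun X => X.1 = i), eX1]
    · funext j
      calc marginalDist₂ pr₁ j = ∑ s : I × J × L, if s.2.1 = j then pr₁ s else 0 :=
            (sum_ite_snd_fst_eq pr₁ j).symm
        _ = ∑ T, if T.1.2.1 = j then Qt T else 0 := by
            simp_rw [pr₁_eq]; exact (sum_ite_fst_sum₃ (fun s : I × J × L => s.2.1 = j) _).symm
        _ = ∑ XYZ, if XYZ.2.1.1 = j then Q' XYZ else 0 :=
            tr (fun T => T.1.2.1 = j) (fun XYZ => XYZ.2.1.1 = j) fun _ => Iff.rfl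
        _ = marginalDist₂ P j := by rw [bY (fun Y => Y.1 = j), eY1]
    · funext l
      calc marginalDist₃ pr₁ l = ∑ s : I × J × L, if s.2.2 = l then pr₁ s else 0 :=
            (sum_ite_snd_snd_eq pr₁ l).symm
        _ = ∑ T, if T.1.2.2 = l then Qt T else 0 := by
            simp_rw [pr₁_eq]; exact (sum_ite_fst_sum₃ (fun s : I × J × L => s.2.2 = l) _).symm
        _ = ∑ XYZ, if XYZ.2.2.1 = l then Q' XYZ else 0 :=
            tr (fun T => T.1.2.2 = l) (fun XYZ => XYZ.2.2.1 = l) fun _ => Iff.rfl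
        _ = marginalDist₃ P l := by rw [bZ (fun Z => Z.1 = l), eZ1]
  have mem₂ : pr₂ ∈ sameMarginalsOn S P := by
    refine ⟨⟨fun s => Finset.sum_nonneg fun b _ => hQ23simp.1 _, ?_⟩, fun s hs => ?_, ?_, ?_, ?_⟩
    · simp only [hpr₂]
      rw [← hQ23simp.2]
      exact (Fintype.sum_prod_type Q23).symm
    · rw [pr₂_eq]
      exact Finset.sum_eq_zero fun a _ => Finset.sum_eq_zero fun c _ => hQtS _ fun h => hs h.2.1
    · funext i
      calc marginalDist₁ pr₂ i = ∑ s : I × J × L, if s.1 = i then pr₂ s else 0 :=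
            (sum_ite_fst_eq pr₂ i).symm
        _ = ∑ T, if T.2.1.1 = i then Qt T else 0 := by
            simp_rw [pr₂_eq]; exact (sum_ite_snd_sum₃ (fun s : I × J × L => s.1 = i) _).symm
        _ = ∑ XYZ, if XYZ.2.2.2.1 = i then Q' XYZ else 0 :=
            tr (fun T => T.2.1.1 = i) (fun XYZ => XYZ.2.2.2.1 = i) fun _ => Iff.rfl
        _ = marginalDist₁ P i := by rw [bZ (fun Z => Z.2.1 = i), eZ2]
    · funext j
      calc marginalDist₂ pr₂ j = ∑ s : I × J × L, if s.2.1 = j then pr₂ s else 0 :=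
            (sum_ite_snd_fst_eq pr₂ j).symm
        _ = ∑ T, if T.2.1.2.1 = j then Qt T else 0 := by
            simp_rw [pr₂_eq]; exact (sum_ite_snd_sum₃ (fun s : I × J × L => s.2.1 = j) _).symm
        _ = ∑ XYZ, if XYZ.1.2.1 = j then Q' XYZ else 0 :=
            tr (fun T => T.2.1.2.1 = j) (fun XYZ => XYZ.1.2.1 = j) fun _ => Iff.rfl
        _ = marginalDist₂ P j := by rw [bX (fun X => X.2.1 = j), eX2]
    · funext l
      calc marginalDist₃ pr₂ l = ∑ s : I × J × L, if s.2.2 = l then pr₂ s else 0 :=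
            (sum_ite_snd_snd_eq pr₂ l).symm
        _ = ∑ T, if T.2.1.2.2 = l then Qt T else 0 := by
            simp_rw [pr₂_eq]; exact (sum_ite_snd_sum₃ (fun s : I × J × L => s.2.2 = l) _).symm
        _ = ∑ XYZ, if XYZ.2.1.2.1 = l then Q' XYZ else 0 :=
            tr (fun T => T.2.1.2.2 = l) (fun XYZ => XYZ.2.1.2.1 = l) fun _ => Iff.rfl
        _ = marginalDist₃ P l := by rw [bY (fun Y => Y.2.1 = l), eY2]
  have mem₃ : pr₃ ∈ sameMarginalsOn S P := by
    refine ⟨⟨fun s => Finset.sum_nonneg fun b _ => hQ23simp.1 _, ?_⟩, fun s hs => ?_, ?_, ?_, ?_⟩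
    · simp only [hpr₃]
      rw [← hQ23simp.2, Finset.sum_comm]
      exact (Fintype.sum_prod_type Q23).symm
    · rw [pr₃_eq]
      exact Finset.sum_eq_zero fun a _ => Finset.sum_eq_zero fun b _ => hQtS _ fun h => hs h.2.2
    · funext i
      calc marginalDist₁ pr₃ i = ∑ s : I × J × L, if s.1 = i then pr₃ s else 0 :=
            (sum_ite_fst_eq pr₃ i).symm
        _ = ∑ T, if T.2.2.1 = i then Qt T else 0 := by
            simp_rw [pr₃_eq]; exact (sum_ite_thd_sum₃ (fun s : I × J × L => s.1 = i) _).symm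
        _ = ∑ XYZ, if XYZ.2.1.2.2 = i then Q' XYZ else 0 :=
            tr (fun T => T.2.2.1 = i) (fun XYZ => XYZ.2.1.2.2 = i) fun _ => Iff.rfl
        _ = marginalDist₁ P i := by rw [bY (fun Y => Y.2.2 = i), eY3]
    · funext j
      calc marginalDist₂ pr₃ j = ∑ s : I × J × L, if s.2.1 = j then pr₃ s else 0 :=
            (sum_ite_snd_fst_eq pr₃ j).symm
        _ = ∑ T, if T.2.2.2.1 = j then Qt T else 0 := by
            simp_rw [pr₃_eq]; exact (sum_ite_thd_sum₃ (fun s : I × J × L => s.2.1 = j) _).symm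
        _ = ∑ XYZ, if XYZ.2.2.2.2 = j then Q' XYZ else 0 :=
            tr (fun T => T.2.2.2.1 = j) (fun XYZ => XYZ.2.2.2.2 = j) fun _ => Iff.rfl
        _ = marginalDist₂ P j := by rw [bZ (fun Z => Z.2.2 = j), eZ3]
    · funext l
      calc marginalDist₃ pr₃ l = ∑ s : I × J × L, if s.2.2 = l then pr₃ s else 0 :=
            (sum_ite_snd_snd_eq pr₃ l).symm
        _ = ∑ T, if T.2.2.2.2 = l then Qt T else 0 := by
            simp_rw [pr₃_eq]; exact (sum_ite_thd_sum₃ (fun s : I × J × L => s.2.2 = l) _).symm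
        _ = ∑ XYZ, if XYZ.1.2.2 = l then Q' XYZ else 0 :=
            tr (fun T => T.2.2.2.2 = l) (fun XYZ => XYZ.1.2.2 = l) fun _ => Iff.rfl
        _ = marginalDist₃ P l := by rw [bX (fun X => X.2.2 = l), eX3]
  -- conclude
  have h1 := shannonEntropy_le_maxEntropyGivenMarginals mem₁
  have h2 := shannonEntropy_le_maxEntropyGivenMarginals mem₂
  have h3 := shannonEntropy_le_maxEntropyGivenMarginals mem₃
  linarith

/-- **`Γ_{S'}(P ⊗ P ⊗ P) ≤ 3 Γ_S(P)`** for the induced support `S'` of `t ⊗ t_C ⊗ t_{C²}`.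
[cite: LeGall2014, Appendix A.3 (p. 24)] -/
theorem maxEntropyPenalty_symSupport_symDist_le (S : Finset (I × J × L))
    {P : I × J × L → ℝ} (hP0 : ∀ s, 0 ≤ P s) (hP1 : ∑ s, P s = 1) (hPS : ∀ s, s ∉ S → P s = 0) :
    maxEntropyPenalty (symSupport S) (symDist P) ≤ 3 * maxEntropyPenalty S P := by
  simp only [maxEntropyPenalty]
  rw [shannonEntropy_symDist hP1]
  linarith [maxEntropyGivenMarginals_symSupport_symDist_le S hP0 hP1 hPS]

end Penalty

end Literature.Computability.AlgebraicComplexity
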